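import Summits.AtomisticToContinuum.FouriersLaw.Theses.VanishingNoiseTransfer
import Literature.MathematicalPhysics.KineticTheory.VelocityFlipNoise
import HarnessLib.Audit

/-!
# Line `abel-kapitza-even-corrector` — crux `VanishingNoiseTransfer.NoisyFourier` (stmt-AtomisticToContinuum-11977)

Skeleton (crux-plan, round 1) of idea card `abel-kapitza-even-corrector` (ideator 1; triage r1: pass ×3).
The crux is `NoisyFourier` = "for every flip rate `ε > 0`, `FlipFouriersLawFor (pinnedChain ω₂ lam β γ) ε`":
(i) the weak steady state of `L + εS` exists and is unique for all `N, T_L, T_R > 0`; (ii) there is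
`κ_ε(T) > 0` such that along every flip-steady family the Bonetto–Lebowitz–Rey-Bellet responses
`D_N(ε) = lim_{δ→0} totalCurrent(μ_{N,T+δ/2,T-δ/2})/δ` exist and `D_N(ε) → κ_ε(T)`.

THE LINE (equilibrium only). Clause (ii) takes `δ → 0` BEFORE `N → ∞`, so it is a statement about
the equal-temperature linear response, i.e. about the open-chain Kubo functional
`σ_N(s) = ⟨J_N, (s - L_{N,ε})⁻¹ J_N⟩_{L²(μ_{N,T})}` (`μ_{N,T}` = Gibbs measure of the open N-chain,
`J_N = Σ_bonds j_i` the total current, `L_{N,ε}` the flip-noisy generator with both baths at `T`),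
Abel-regularised at `s > 0`: `D_N(ε) = lim_{s→0⁺} σ_N(s)/(T²(N-1))` (stub `NoisyKuboAbel`). The
corrector `u_s = (s - L_{N,ε})⁻¹ J_N` is introduced WEAKLY (`IsAbelCorrector`: an `L²(μ_{N,T})`
function with `∫ u (s g - L† g) dμ = ∫ J_N g dμ` for all test `g`, `L† = Π L_{N,ε} Π`, `Π` the global
momentum reversal), so no operator theory is needed to STATE anything; its well-posedness is stub
`AbelCorrectorWellPosed`. The flip Dirichlet form is the sector multiplier `2ε·#{odd momenta}`, so the
odd sectors of `u_s` cost nothing and (stub `AbelTransfer`, the lever) the resolvent identity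
`σ_N(s') - σ_N(s) = (s' - s)⟨Π u_{s'}, u_s⟩` turns the KAPITZA BOUND (stub `KapitzaBound`, the card's
C⁺: `∫ (P₀ u_s)² dμ_{N,T} ≤ M·N` uniformly in `N ≥ 2`, `s ∈ (0,1]`, `P₀` = average over the `2^N`
momentum-sign patterns = projection onto `ker S`) into an `N`-UNIFORM LIPSCHITZ bound
`|σ_N(s) - σ_N(s')| ≤ C (N-1)|s - s'|` on `(0,1]`. With the fixed-`s` thermodynamic limit
`σ_N(s)/(N-1) → K_∞(s)` (stub `FixedAbelThermodynamicLimit`, finite effective time horizon `1/s`)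
the Moore–Osgood double-limit theorem — PROVED below as `abel_mooreOsgood`, pure real analysis —
gives `D_N(ε) → κ_ε(T) := lim_{s→0⁺} K_∞(s)/T²`; positivity `κ_ε(T) > 0` is imported from the
Thomson side (stub `ThomsonFloor`: `σ_N(s) ≥ c(N-1)`, the output format of the sibling witness cards
`half-conserved-witness` / `cell-parity-thomson-witness`), and clause (i) is stub
`NoisyNessExistsUnique` (print-level: BO2011 Prop 1/§8 + CEHRB2018 + weak-FP identification).

Registered stubs (7, sorried): `stub_noisyNessExistsUnique`, `stub_abelCorrectorWellPosed`,
`stub_noisyKuboAbel`, `stub_fixedAbelThermodynamicLimit`, `stub_kapitzaBound` (HARDEST),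
`stub_abelTransfer`, `stub_thomsonFloor`. Composition (sorry-free): `abel_mooreOsgood`,
`flipFouriersLawFor_of_parts` (the seven statements ⟹ `FlipFouriersLawFor` at every ε > 0, hypotheses
explicit), `NoisyFourier_of` (concludes the crux BY NAME from the registered stubs).

Disproof.lean (cdisprove, evidence notes; body not mounted in this jail) honoured: γ > 0 is used by
`NoisyNessExistsUnique` (`noisyFourier_false_without_bathCoupling`); only CONVERGENCE of `D_N` is
claimed, `D_0 = D_1 = 0` allowed (`not_noisyFourierPointwise`); the ∀-family quantifier is handled by
uniqueness transport (`flipFouriersLawFor_iff_exists_family`); ε > 0 enters every stub through the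
sector constant `2ε` (`noisyFourierWithoutNoise_iff`: at ε = 0 the statement contains the target).
-/

noncomputable section

open MeasureTheory Filter Topology
open scoped ContDiff BigOperators

namespace Summit.AtomisticToContinuum.FouriersLaw.Cruxes.NoisyFourier.AbelKapitzaEvenCorrector

open Literature.MathematicalPhysics.KineticTheory.HeatConduction
open Summit.AtomisticToContinuum.FouriersLaw.Theses.VanishingNoiseTransfer (NoisyFourier)

variable {N : ℕ}

/-! ## Local objects (all elementary; no operator theory) -/

/-- Global momentum reversal `Π (q, p) = (q, -p)`. In `L²` of any Gibbs measure `Π L_{N,ε} Π = L†`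
(Liouville part antisymmetric, baths and flips symmetric; BernardinOlla2011 §2.1, §5 p. 12). -/
def reversal (x : PhaseSpace N) : PhaseSpace N := (x.1, -x.2)

/-- The momentum sign pattern `σ ∈ {±1}^N` acting on phase space: `p_i ↦ -p_i` where `σ i`. -/
def signFlip (σ : Fin N → Bool) (x : PhaseSpace N) : PhaseSpace N :=
  (x.1, fun i => if σ i then -x.2 i else x.2 i)

/-- `P₀ u` — the average of `u` over the `2^N` momentum-sign patterns: the `L²(μ_{N,T})`-orthogonal
projection onto the functions EVEN IN EVERY MOMENTUM, i.e. onto `ker S` (the energy / temperature-profile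
sector `H₀`; `S = -2·#odd` on the sector with a given set of odd momenta, BernardinOlla2011 Lemma 2). -/
def evenPart (u : PhaseSpace N → ℝ) (x : PhaseSpace N) : ℝ :=
  (∑ σ : Fin N → Bool, u (signFlip σ x)) / 2 ^ N

/-- The total instantaneous energy current `J_N = Σ_i j_i` (a FUNCTION on phase space; its steady
expectation is `OscillatorChain.totalCurrent`). -/
def totalCurrentFn (P : OscillatorChain) (N : ℕ) (x : PhaseSpace N) : ℝ :=
  ∑ i : Fin N, P.bondCurrent N i x

/-- The formal `L²(μ_{N,T})`-adjoint of the flip-noisy generator at equal bath temperatures `T`: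
`L† g = Π (L_{N,ε} (g ∘ Π))`, i.e. `-A + γ B_T + ε S` on smooth `g`. -/
def adjointFlipGenerator (P : OscillatorChain) (N : ℕ) (T ε : ℝ) (g : PhaseSpace N → ℝ)
    (x : PhaseSpace N) : ℝ :=
  P.flipGenerator N T T ε (fun y => g (reversal y)) (reversal x)

/-- `IsAbelCorrector P N T ε s u`: `u` is a WEAK square-integrable solution of the resolvent equation
`(s - L_{N,ε}) u = J_N` in `L²(μ_{N,T})`, `μ_{N,T} = P.gibbsMeasure N T`:
`u ∈ L²(μ_{N,T})` and `∫ u · (s g - L† g) dμ_{N,T} = ∫ J_N · g dμ_{N,T}` for every `g ∈ C_c^∞`.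
(For `s > 0` this is `u = u_s = (s - L_{N,ε})⁻¹ J_N`, BernardinOlla2011 §5, at finite `N` with baths.) -/
def IsAbelCorrector (P : OscillatorChain) (N : ℕ) (T ε s : ℝ) (u : PhaseSpace N → ℝ) : Prop :=
  MemLp u 2 (P.gibbsMeasure N T) ∧
    ∀ g : PhaseSpace N → ℝ, ContDiff ℝ ∞ g → HasCompactSupport g →
      ∫ x, u x * (s * g x - adjointFlipGenerator P N T ε g x) ∂(P.gibbsMeasure N T) =
        ∫ x, totalCurrentFn P N x * g x ∂(P.gibbsMeasure N T)

/-- The Abel-regularised open-chain Kubo functional `σ_N(s)[u] = ∫ J_N · u dμ_{N,T}` (for the corrector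
`u = u_s` this is `⟨J_N, (s - L_{N,ε})⁻¹ J_N⟩ ≥ 0`; `K_N(s) = σ_N(s)/(N-1)`). -/
def kuboForm (P : OscillatorChain) (N : ℕ) (T : ℝ) (u : PhaseSpace N → ℝ) : ℝ :=
  ∫ x, totalCurrentFn P N x * u x ∂(P.gibbsMeasure N T)

/-! ## Stub statements (precise `Prop`s; the hypotheses of `flipFouriersLawFor_of_parts`, discharged by the
registered `stub_*` theorems in `NoisyFourier_of`) -/

/-- STUB 1 statement — clause (i) of the crux at every rate: for the pinned anharmonic chain with flips at
rate `ε > 0` between Langevin baths, the weak flip steady state (`IsFlipSteadyState`: probability measure,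
`∫ (L + εS) f dμ = 0` on `C_c^∞`, integrable bond currents) exists and is unique for all `N`, `T_L, T_R > 0`.
Print-level: BernardinOlla2011 Prop 1 + §8 (Lyapunov `e^{θH}`, Duhamel in the flips; unpinned chain),
CuneoEckmannHairerReyBellet2018 Thm 2.13 (pinned Lyapunov/Harris structure), plus the weak
Fokker–Planck identification (as in route support `NessUnique`, stmt-0741). Uses `γ > 0`
(Disproof `noisyFourier_false_without_bathCoupling`). -/
def NoisyNessExistsUnique : Prop :=
  ∀ ω₂ lam β γ : ℝ, 0 < ω₂ → 0 < lam → 0 < β → 0 < γ → ∀ ε : ℝ, 0 < ε →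
    ∀ (N : ℕ) (T_L T_R : ℝ), 0 < T_L → 0 < T_R →
      ∃ μ : Measure (PhaseSpace N), (pinnedChain ω₂ lam β γ).IsFlipSteadyState N T_L T_R ε μ ∧
        ∀ ν : Measure (PhaseSpace N), (pinnedChain ω₂ lam β γ).IsFlipSteadyState N T_L T_R ε ν → ν = μ

/-- STUB 2 statement — WELL-POSEDNESS OF THE ABEL CORRECTOR: for every `N`, `T > 0`, `ε > 0`, `s > 0` the
weak resolvent equation `(s - L_{N,ε}) u = J_N` has a square-integrable solution, unique `μ_{N,T}`-a.e.
(essential m-dissipativity of the hypoelliptic Langevin generator with polynomial potentials on `C_c^∞`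
in `L²(Gibbs)` — Helffer–Nier-type — plus the bounded perturbation `εS`, `‖S‖ ≤ 2N`; `J_N ∈ L²(μ_{N,T})`). -/
def AbelCorrectorWellPosed : Prop :=
  ∀ ω₂ lam β γ : ℝ, 0 < ω₂ → 0 < lam → 0 < β → 0 < γ → ∀ ε : ℝ, 0 < ε →
    ∀ (N : ℕ) (T : ℝ), 0 < T → ∀ s : ℝ, 0 < s →
      ∃ u : PhaseSpace N → ℝ, IsAbelCorrector (pinnedChain ω₂ lam β γ) N T ε s u ∧
        ∀ v : PhaseSpace N → ℝ, IsAbelCorrector (pinnedChain ω₂ lam β γ) N T ε s v →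
          v =ᵐ[(pinnedChain ω₂ lam β γ).gibbsMeasure N T] u

/-- STUB 3 statement — NOISY KUBO–ABEL IDENTITY (fixed `N`, linear response of the flip chain): along the
UNIQUE flip-steady family (triage sharpening: uniqueness is part of the hypothesis) and for every `T > 0`,
`N`: the BLR response `D_N(ε) = lim_{δ→0, δ≠0} totalCurrent(μ_{N,T+δ/2,T-δ/2})/δ` EXISTS, and for
`N ≥ 2` it is the Abel limit of the open-chain Kubo functional along any family of correctors:
`D_N(ε) = lim_{s→0⁺} σ_N(s)/(T²(N-1))` (`D_0 = D_1 = 0`: no bond). Content: differentiability of the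
flip NESS at equilibrium (HairerMajda2009 framework / ReyBellet2003 Rem 4.4 with the bounded jump
perturbation), first-order stationarity `⟨L u, h⟩ = -⟨∂_δ L u⟩`, `Π L Π = L†`, bond-independence of
`⟨j_x, (-L)⁻¹ j_y⟩` (open-chain Kubo formula, KunduDharNarayan2009 eqs (10)–(12); verified exactly on
harmonic + flips with the tree's conventions, triage r1-2 `kdn_purepy.py`). -/
def NoisyKuboAbel : Prop :=
  ∀ ω₂ lam β γ : ℝ, 0 < ω₂ → 0 < lam → 0 < β → 0 < γ → ∀ ε : ℝ, 0 < ε →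
    ∀ μ : (N : ℕ) → ℝ → ℝ → Measure (PhaseSpace N),
      (∀ (N : ℕ) (T_L T_R : ℝ), 0 < T_L → 0 < T_R →
        (pinnedChain ω₂ lam β γ).IsFlipSteadyState N T_L T_R ε (μ N T_L T_R) ∧
          ∀ ν : Measure (PhaseSpace N),
            (pinnedChain ω₂ lam β γ).IsFlipSteadyState N T_L T_R ε ν → ν = μ N T_L T_R) →
      ∀ T : ℝ, 0 < T → ∀ N : ℕ, ∃ D : ℝ,
        Tendsto (fun δ : ℝ =>
          (pinnedChain ω₂ lam β γ).totalCurrent (μ N (T + δ / 2) (T - δ / 2)) / δ) (𝓝[≠] 0) (𝓝 D) ∧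
        (2 ≤ N → ∀ u : ℝ → PhaseSpace N → ℝ,
          (∀ s : ℝ, 0 < s → s ≤ 1 → IsAbelCorrector (pinnedChain ω₂ lam β γ) N T ε s (u s)) →
          Tendsto (fun s : ℝ => kuboForm (pinnedChain ω₂ lam β γ) N T (u s) / (T ^ 2 * ((N : ℝ) - 1)))
            (𝓝[>] 0) (𝓝 D))

/-- STUB 4 statement — THERMODYNAMIC LIMIT AT FIXED ABEL PARAMETER: for every `s ∈ (0,1]` the per-bond
Kubo functional `K_N(s) = σ_N(s)/(N-1)` converges as `N → ∞` along every family of correctors.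
Content: at `s > 0` the resolvent weights times `≳ 1/s` by `e^{-st}`, so by finite-speed (light-cone)
locality of the flip-noisy dynamics each bond's contribution is determined up to `O(e^{-c s d})` by a
`d`-neighbourhood, boundary bonds contribute `O(1/(sN))`; needs the infinite-volume flip dynamics of the
quartic pinned chain (tree: `InfiniteChainSuperstableDynamics`, `InfiniteChainLightCone` + bounded-rate
flips; BernardinOlla2011 §5 assumes this framework, "easily proved" only for bounded `V''`). The value
of the limit (BO2011's `⟪j,(s-L)⁻¹j⟫`) is NOT needed. -/
def FixedAbelThermodynamicLimit : Prop :=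
  ∀ ω₂ lam β γ : ℝ, 0 < ω₂ → 0 < lam → 0 < β → 0 < γ → ∀ ε : ℝ, 0 < ε → ∀ T : ℝ, 0 < T →
    ∀ s : ℝ, 0 < s → s ≤ 1 → ∀ u : (N : ℕ) → PhaseSpace N → ℝ,
      (∀ N : ℕ, 2 ≤ N → IsAbelCorrector (pinnedChain ω₂ lam β γ) N T ε s (u N)) →
      ∃ K : ℝ, Tendsto (fun N : ℕ => kuboForm (pinnedChain ω₂ lam β γ) N T (u N) / ((N : ℝ) - 1))
        atTop (𝓝 K)

/-- STUB 5 statement — THE KAPITZA BOUND (the card's `C⁺`, HARDEST): the even (energy-sector) part of the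
Abel corrector has `L²(μ_{N,T})`-norm `O(√N)`, uniformly in `N ≥ 2` AND in `s ∈ (0,1]`:
`∫ (P₀ u_s)² dμ_{N,T} ≤ M·N`. Heuristic content (fluctuating hydrodynamics): `P₀ u ≈ Σ_x φ_N(x)(e_x - ē)`
with `|φ_N| ≤ ℓ` = Kapitza (contact) length of the bath–chain junction, so the bound says "normal transport
with `O(1)` contact resistance"; it fails, as it must, only in the ballistic `ε = 0` harmonic corner
(`ℓ ~ N`). Calibrated exactly on harmonic + flips (kit j005267: `K0/N → a(ε)`); the odd sectors and the
even sectors `H₂, H₄, …` are `O(√N)` for free (`‖P_{W≥1} u_s‖ ≤ ‖J_N‖/(2ε)`), so `P₀` is the whole content. -/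
def KapitzaBound : Prop :=
  ∀ ω₂ lam β γ : ℝ, 0 < ω₂ → 0 < lam → 0 < β → 0 < γ → ∀ ε : ℝ, 0 < ε → ∀ T : ℝ, 0 < T →
    ∃ M : ℝ, ∀ N : ℕ, 2 ≤ N → ∀ s : ℝ, 0 < s → s ≤ 1 → ∀ u : PhaseSpace N → ℝ,
      IsAbelCorrector (pinnedChain ω₂ lam β γ) N T ε s u →
        ∫ x, (evenPart u x) ^ 2 ∂((pinnedChain ω₂ lam β γ).gibbsMeasure N T) ≤ M * N

/-- STUB 6 statement — THE ABEL TRANSFER (the lever): a Kapitza bound with constant `M` at given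
parameters implies an `N`-UNIFORM LIPSCHITZ bound for the Kubo functional in the Abel variable on `(0,1]`:
`|σ_N(s) - σ_N(s')| ≤ C·(N-1)·|s - s'|` for all `N ≥ 2` and all correctors at `s, s'`. Mechanism:
resolvent identity + `Π`-adjointness give `σ_N(s') - σ_N(s) = (s' - s)(⟨u^s_{s'}, u^s_s⟩ - ⟨u^a_{s'}, u^a_s⟩)`
(`u^{s/a}` the `Π`-even/odd parts; BO2011 p. 12); sector coercivity of the flips for WEAK solutions
(`⟨J_N, u_s⟩ = s‖u_s‖² + ε⟨u_s, -S u_s⟩ + γ𝓑(u_s) ≥ 2ε‖P_{W≥1} u_s‖²`, `J_N ∈ H_{W=1}`) bounds every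
sector except `P₀` by `‖J_N‖/(2ε) = O(√N)` (Gibbs second moments of `J_N`: only neighbouring bonds
correlate); the `P₀` part is the hypothesis. -/
def AbelTransfer : Prop :=
  ∀ ω₂ lam β γ : ℝ, 0 < ω₂ → 0 < lam → 0 < β → 0 < γ → ∀ ε : ℝ, 0 < ε → ∀ T : ℝ, 0 < T → ∀ M : ℝ,
    (∀ N : ℕ, 2 ≤ N → ∀ s : ℝ, 0 < s → s ≤ 1 → ∀ u : PhaseSpace N → ℝ,
      IsAbelCorrector (pinnedChain ω₂ lam β γ) N T ε s u →
        ∫ x, (evenPart u x) ^ 2 ∂((pinnedChain ω₂ lam β γ).gibbsMeasure N T) ≤ M * N) →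
    ∃ C : ℝ, ∀ N : ℕ, 2 ≤ N → ∀ s s' : ℝ, 0 < s → s ≤ 1 → 0 < s' → s' ≤ 1 →
      ∀ u u' : PhaseSpace N → ℝ,
        IsAbelCorrector (pinnedChain ω₂ lam β γ) N T ε s u →
        IsAbelCorrector (pinnedChain ω₂ lam β γ) N T ε s' u' →
          |kuboForm (pinnedChain ω₂ lam β γ) N T u - kuboForm (pinnedChain ω₂ lam β γ) N T u'| ≤
            C * ((N : ℝ) - 1) * |s - s'|

/-- STUB 7 statement — THOMSON FLOOR (positivity, imported from the sibling witness cards): the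
Abel-regularised Kubo functional is extensive from below, `σ_N(s) ≥ c·(N-1)` with `c > 0`, for `N ≥ N₀`
and `s ∈ (0,1]`. Content: a flip-admissible Thomson witness in BO2011's sup-formula (var) — an odd field `w`
with `P₀(A w)` absorbable and `⟪w, j⟫ ≠ 0` — gives `σ ≥ ⟪w,j⟫²/(s‖w‖² + 2εW‖w‖² + Σ_k‖(Aw)_{2k}‖²/(4kε))`
(cards `half-conserved-witness`, `cell-parity-thomson-witness`), or a finite certificate
(`parity-coercive-one-sided-fekete`). OPEN IN PRINT for the pinned chain (BO2011 §6.2 p. 14). -/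
def ThomsonFloor : Prop :=
  ∀ ω₂ lam β γ : ℝ, 0 < ω₂ → 0 < lam → 0 < β → 0 < γ → ∀ ε : ℝ, 0 < ε → ∀ T : ℝ, 0 < T →
    ∃ c : ℝ, 0 < c ∧ ∃ N₀ : ℕ, ∀ N : ℕ, N₀ ≤ N → ∀ s : ℝ, 0 < s → s ≤ 1 → ∀ u : PhaseSpace N → ℝ,
      IsAbelCorrector (pinnedChain ω₂ lam β γ) N T ε s u →
        c * ((N : ℝ) - 1) ≤ kuboForm (pinnedChain ω₂ lam β γ) N T u

/-! ## Registered stubs -/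

/-- STUB 1 (size L): flip NESS existence + weak uniqueness at every rate (clause (i)). -/
theorem stub_noisyNessExistsUnique : NoisyNessExistsUnique := by
  sorry

/-- STUB 2 (size M): weak `L²` resolvent well-posedness for `L_{N,ε}` at `s > 0`. -/
theorem stub_abelCorrectorWellPosed : AbelCorrectorWellPosed := by
  sorry

/-- STUB 3 (size L): fixed-`N` linear response + open-chain Kubo–Abel identity for the flip chain. -/
theorem stub_noisyKuboAbel : NoisyKuboAbel := by
  sorry

/-- STUB 4 (size L–XL): the fixed-`s` thermodynamic limit of `σ_N(s)/(N-1)` (light-cone locality). -/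
theorem stub_fixedAbelThermodynamicLimit : FixedAbelThermodynamicLimit := by
  sorry

/-- STUB 5 (size XL, the HARDEST — the card's `C⁺`): the Kapitza bound on `P₀ u_s`. -/
theorem stub_kapitzaBound : KapitzaBound := by
  sorry

/-- STUB 6 (size M–L, the lever): Kapitza ⇒ `N`-uniform Lipschitz continuity in the Abel variable. -/
theorem stub_abelTransfer : AbelTransfer := by
  sorry

/-- STUB 7 (size L; open in print): the Thomson floor `σ_N(s) ≥ c(N-1)`. -/
theorem stub_thomsonFloor : ThomsonFloor := by
  sorry

/-! ## Composition (sorry-free) -/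

/-- **Abel–Moore–Osgood transfer** (pure real analysis, the planner-proved heart of the line): if the
functions `K_N` are eventually `C`-Lipschitz on `(0,1]` uniformly in `N`, have Abel limits `K_N(0⁺) = D_N`,
converge pointwise in `N` at each fixed `s ∈ (0,1]`, and are eventually bounded below by `c > 0`, then
`D_N` converges to a positive limit. -/
theorem abel_mooreOsgood (K : ℕ → ℝ → ℝ) (D : ℕ → ℝ) (C c : ℝ) (hc : 0 < c)
    (hlip : ∀ᶠ N in atTop, ∀ s s' : ℝ, 0 < s → s ≤ 1 → 0 < s' → s' ≤ 1 →
      |K N s - K N s'| ≤ C * |s - s'|)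
    (habel : ∀ᶠ N in atTop, Tendsto (K N) (𝓝[>] 0) (𝓝 (D N)))
    (htl : ∀ s : ℝ, 0 < s → s ≤ 1 → ∃ L : ℝ, Tendsto (fun N => K N s) atTop (𝓝 L))
    (hfloor : ∀ᶠ N in atTop, ∀ s : ℝ, 0 < s → s ≤ 1 → c ≤ K N s) :
    ∃ κ : ℝ, 0 < κ ∧ Tendsto D atTop (𝓝 κ) := by
  -- a positive Lipschitz constant
  set C' : ℝ := max C 1 with hC'
  have hC'pos : 0 < C' := lt_of_lt_of_le one_pos (le_max_right _ _)
  have hCC' : C ≤ C' := le_max_left _ _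
  -- (a) eventually in N: |D N - K N s| ≤ C' s for every s ∈ (0,1]
  have hA : ∀ᶠ N in atTop, ∀ s : ℝ, 0 < s → s ≤ 1 → |D N - K N s| ≤ C' * s := by
    filter_upwards [hlip, habel] with N hl ha s hs hs1
    have h1 : Tendsto (fun s' => |K N s - K N s'|) (𝓝[>] 0) (𝓝 (|K N s - D N|)) :=
      ((tendsto_const_nhds.sub ha).abs)
    have h2 : Tendsto (fun s' : ℝ => C' * |s - s'|) (𝓝[>] 0) (𝓝 (C' * |s - 0|)) :=
      ((tendsto_const_nhds.sub (tendsto_nhdsWithin_of_tendsto_nhds tendsto_id)).abs.const_mul C')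
    have h3 : ∀ᶠ s' in 𝓝[>] (0 : ℝ), |K N s - K N s'| ≤ C' * |s - s'| := by
      have hmem : Set.Ioc (0 : ℝ) 1 ∈ 𝓝[>] (0 : ℝ) := Ioc_mem_nhdsGT one_pos
      filter_upwards [hmem] with s' hs'
      calc |K N s - K N s'| ≤ C * |s - s'| := hl s s' hs hs1 hs'.1 hs'.2
        _ ≤ C' * |s - s'| := mul_le_mul_of_nonneg_right hCC' (abs_nonneg _)
    have h4 := le_of_tendsto_of_tendsto h1 h2 h3
    rw [sub_zero, abs_of_pos hs] at h4
    rwa [abs_sub_comm] at h4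
  -- (b) for every η > 0 there is L with |D N - L| < η eventually
  have hB : ∀ η : ℝ, 0 < η → ∃ L : ℝ, ∀ᶠ N in atTop, |D N - L| < η := by
    intro η hη
    set s : ℝ := min 1 (η / (4 * C')) with hsdef
    have hs : 0 < s := lt_min one_pos (by positivity)
    have hs1 : s ≤ 1 := min_le_left _ _
    have hsC : C' * s ≤ η / 4 := by
      calc C' * s ≤ C' * (η / (4 * C')) := mul_le_mul_of_nonneg_left (min_le_right _ _) hC'pos.le
        _ = η / 4 := by field_simp
    obtain ⟨L, hL⟩ := htl s hs hs1
    refine ⟨L, ?_⟩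
    have hL' : ∀ᶠ N in atTop, |K N s - L| < η / 4 := by
      have := (Metric.tendsto_nhds.mp hL) (η / 4) (by positivity)
      simpa only [Real.dist_eq] using this
    filter_upwards [hA, hL'] with N hAN hLN
    calc |D N - L| ≤ |D N - K N s| + |K N s - L| := abs_sub_le _ _ _
      _ < η / 4 + η / 4 := by linarith [hAN s hs hs1]
      _ ≤ η := by linarith
  -- (c) D is Cauchy, hence convergent
  have hcauchy : CauchySeq D := by
    refine Metric.cauchySeq_iff.2 fun η hη => ?_
    obtain ⟨L, hL⟩ := hB (η / 2) (by positivity)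
    obtain ⟨N₁, hN₁⟩ := hL.exists_forall_of_atTop
    refine ⟨N₁, fun m hm n hn => ?_⟩
    rw [Real.dist_eq]
    calc |D m - D n| ≤ |D m - L| + |L - D n| := abs_sub_le _ _ _
      _ = |D m - L| + |D n - L| := by rw [abs_sub_comm L (D n)]
      _ < η := by linarith [hN₁ m hm, hN₁ n hn]
  obtain ⟨κ, hκ⟩ := cauchySeq_tendsto_of_complete hcauchy
  -- (d) positivity: c - C' s ≤ κ for every s ∈ (0,1]
  have hlow : ∀ s : ℝ, 0 < s → s ≤ 1 → c - C' * s ≤ κ := by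
    intro s hs hs1
    have hev : ∀ᶠ N in atTop, c - C' * s ≤ D N := by
      filter_upwards [hA, hfloor] with N hAN hfN
      have h1 := hfN s hs hs1
      have h2 := (abs_le.mp (hAN s hs hs1)).1
      linarith
    exact ge_of_tendsto hκ hev
  have hκpos : 0 < κ := by
    by_contra hneg
    push Not at hneg
    set s : ℝ := min 1 (c / (2 * C')) with hsdef
    have hs : 0 < s := lt_min one_pos (by positivity)
    have hs1 : s ≤ 1 := min_le_left _ _
    have hsC : C' * s ≤ c / 2 := by
      calc C' * s ≤ C' * (c / (2 * C')) := mul_le_mul_of_nonneg_left (min_le_right _ _) hC'pos.le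
        _ = c / 2 := by field_simp
    have := hlow s hs hs1
    linarith
  exact ⟨κ, hκpos, hκ⟩

/-- A family of objects chosen at positive temperatures (choice bookkeeping). -/
theorem famChoice {Q : (N : ℕ) → ℝ → ℝ → Measure (PhaseSpace N) → Prop}
    (hQ : ∀ (N : ℕ) (T_L T_R : ℝ), 0 < T_L → 0 < T_R → ∃ μ, Q N T_L T_R μ) :
    ∃ fam : (N : ℕ) → ℝ → ℝ → Measure (PhaseSpace N),
      ∀ (N : ℕ) (T_L T_R : ℝ), 0 < T_L → 0 < T_R → Q N T_L T_R (fam N T_L T_R) := by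
  classical
  refine ⟨fun N T_L T_R => if h : 0 < T_L ∧ 0 < T_R then (hQ N T_L T_R h.1 h.2).choose else 0,
    fun N T_L T_R hL hR => ?_⟩
  simp only [dif_pos (And.intro hL hR)]
  exact (hQ N T_L T_R hL hR).choose_spec

/-- **The line, composed** (sorry-free): the seven stub statements imply `FlipFouriersLawFor` for the
pinned anharmonic chain at every rate `ε > 0`. Clause (i) is stub 1. Clause (ii): fix `T > 0`; take the
reference unique flip-steady family (stub 1 + choice) and a family of Abel correctors `u_{N,s}`
(stub 2 + choice); `K_N(s) := σ_N(s)[u_{N,s}]/(T²(N-1))` has Abel limits `D_N` (stub 3), is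
`N`-uniformly Lipschitz on `(0,1]` (stubs 5 + 6), converges at each fixed `s` (stub 4) and is `≥ c/T²`
(stub 7); `abel_mooreOsgood` gives `D_N → κ_ε(T) > 0`; an arbitrary flip-steady family has the same
response quotients near `δ = 0` by uniqueness (stub 1). -/
theorem flipFouriersLawFor_of_parts (h₁ : NoisyNessExistsUnique) (h₂ : AbelCorrectorWellPosed)
    (h₃ : NoisyKuboAbel) (h₄ : FixedAbelThermodynamicLimit) (h₅ : KapitzaBound) (h₆ : AbelTransfer)
    (h₇ : ThomsonFloor) {ω₂ lam β γ : ℝ} (hω : 0 < ω₂) (hl : 0 < lam) (hβ : 0 < β) (hγ : 0 < γ)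
    {ε : ℝ} (hε : 0 < ε) : (pinnedChain ω₂ lam β γ).FlipFouriersLawFor ε := by
  classical
  set P := pinnedChain ω₂ lam β γ with hP
  have hexu := h₁ ω₂ lam β γ hω hl hβ hγ ε hε
  -- the reference (unique) flip-steady family
  obtain ⟨μ0, hμ0⟩ := famChoice hexu
  have huniq : ∀ (N : ℕ) (T_L T_R : ℝ), 0 < T_L → 0 < T_R → ∀ ν : Measure (PhaseSpace N),
      P.IsFlipSteadyState N T_L T_R ε ν → ν = μ0 N T_L T_R := by
    intro N T_L T_R hL hR ν hν
    obtain ⟨hst, hun⟩ := hμ0 N T_L T_R hL hR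
    exact hun ν hν
  refine ⟨hexu, ?_⟩
  -- main step at a fixed temperature
  have hmain : ∀ T : ℝ, 0 < T → ∃ κT : ℝ, 0 < κT ∧ ∃ D : ℕ → ℝ,
      (∀ N : ℕ, Tendsto (fun δ : ℝ => P.totalCurrent (μ0 N (T + δ / 2) (T - δ / 2)) / δ)
        (𝓝[≠] 0) (𝓝 (D N))) ∧ Tendsto D atTop (𝓝 κT) := by
    intro T hT
    -- responses of the reference family (stub 3)
    have hKA := h₃ ω₂ lam β γ hω hl hβ hγ ε hε μ0 hμ0 T hT
    set D : ℕ → ℝ := fun N => (hKA N).choose with hDdef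
    have hD : ∀ N, Tendsto (fun δ : ℝ => P.totalCurrent (μ0 N (T + δ / 2) (T - δ / 2)) / δ)
        (𝓝[≠] 0) (𝓝 (D N)) ∧
        (2 ≤ N → ∀ u : ℝ → PhaseSpace N → ℝ,
          (∀ s : ℝ, 0 < s → s ≤ 1 → IsAbelCorrector P N T ε s (u s)) →
          Tendsto (fun s : ℝ => kuboForm P N T (u s) / (T ^ 2 * ((N : ℝ) - 1))) (𝓝[>] 0) (𝓝 (D N))) :=
      fun N => (hKA N).choose_spec
    -- a family of Abel correctors (stub 2 + choice)
    have hWP := h₂ ω₂ lam β γ hω hl hβ hγ ε hε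
    set uc : (N : ℕ) → ℝ → PhaseSpace N → ℝ := fun N s =>
      if hs : 0 < s then (hWP N T hT s hs).choose else fun _ => 0 with hucdef
    have huc : ∀ (N : ℕ) (s : ℝ), 0 < s → IsAbelCorrector P N T ε s (uc N s) := by
      intro N s hs
      have : uc N s = (hWP N T hT s hs).choose := by simp only [hucdef, dif_pos hs]
      rw [this]
      exact (hWP N T hT s hs).choose_spec.1
    -- the Abel-regularised per-bond Kubo functional
    set K : ℕ → ℝ → ℝ := fun N s => kuboForm P N T (uc N s) / (T ^ 2 * ((N : ℝ) - 1)) with hKdef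
    have hT2 : 0 < T ^ 2 := by positivity
    -- Lipschitz in s, uniformly in N (stubs 5 + 6)
    obtain ⟨M, hM⟩ := h₅ ω₂ lam β γ hω hl hβ hγ ε hε T hT
    obtain ⟨C, hC⟩ := h₆ ω₂ lam β γ hω hl hβ hγ ε hε T hT M hM
    have hlip : ∀ᶠ N in atTop, ∀ s s' : ℝ, 0 < s → s ≤ 1 → 0 < s' → s' ≤ 1 →
        |K N s - K N s'| ≤ C / T ^ 2 * |s - s'| := by
      filter_upwards [eventually_ge_atTop 2] with N hN s s' hs hs1 hs' hs'1
      have hN1 : 0 < (N : ℝ) - 1 := by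
        have : (2 : ℝ) ≤ N := by exact_mod_cast hN
        linarith
      have hden : 0 < T ^ 2 * ((N : ℝ) - 1) := mul_pos hT2 hN1
      have hb := hC N hN s s' hs hs1 hs' hs'1 (uc N s) (uc N s') (huc N s hs) (huc N s' hs')
      have hK : K N s - K N s' =
          (kuboForm P N T (uc N s) - kuboForm P N T (uc N s')) / (T ^ 2 * ((N : ℝ) - 1)) := by
        simp only [hKdef]; ring
      rw [hK, abs_div, abs_of_pos hden, div_le_iff₀ hden]
      calc |kuboForm P N T (uc N s) - kuboForm P N T (uc N s')| ≤ C * ((N : ℝ) - 1) * |s - s'| := hb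
        _ = C / T ^ 2 * |s - s'| * (T ^ 2 * ((N : ℝ) - 1)) := by field_simp
    -- Abel limits (stub 3)
    have habel : ∀ᶠ N in atTop, Tendsto (K N) (𝓝[>] 0) (𝓝 (D N)) := by
      filter_upwards [eventually_ge_atTop 2] with N hN
      exact (hD N).2 hN (uc N) (fun s hs _ => huc N s hs)
    -- thermodynamic limit at fixed s (stub 4)
    have htl : ∀ s : ℝ, 0 < s → s ≤ 1 → ∃ L : ℝ, Tendsto (fun N => K N s) atTop (𝓝 L) := by
      intro s hs hs1
      obtain ⟨Kinf, hKinf⟩ := h₄ ω₂ lam β γ hω hl hβ hγ ε hε T hT s hs hs1 (fun N => uc N s)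
        (fun N _ => huc N s hs)
      refine ⟨Kinf / T ^ 2, ?_⟩
      have hfun : (fun N => K N s) = fun N : ℕ => (kuboForm P N T (uc N s) / ((N : ℝ) - 1)) / T ^ 2 := by
        funext N
        simp only [hKdef]
        rw [mul_comm, div_mul_eq_div_div]
      rw [hfun]
      exact hKinf.div_const _
    -- floor (stub 7)
    obtain ⟨c, hc, N₀, hfl⟩ := h₇ ω₂ lam β γ hω hl hβ hγ ε hε T hT
    have hfloor : ∀ᶠ N in atTop, ∀ s : ℝ, 0 < s → s ≤ 1 → c / T ^ 2 ≤ K N s := by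
      filter_upwards [eventually_ge_atTop 2, eventually_ge_atTop N₀] with N hN hN₀ s hs hs1
      have hN1 : 0 < (N : ℝ) - 1 := by
        have : (2 : ℝ) ≤ N := by exact_mod_cast hN
        linarith
      have hden : 0 < T ^ 2 * ((N : ℝ) - 1) := mul_pos hT2 hN1
      have hb := hfl N hN₀ s hs hs1 (uc N s) (huc N s hs)
      simp only [hKdef]
      rw [le_div_iff₀ hden]
      calc c / T ^ 2 * (T ^ 2 * ((N : ℝ) - 1)) = c * ((N : ℝ) - 1) := by field_simp
        _ ≤ kuboForm P N T (uc N s) := hb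
    obtain ⟨κT, hκT, hconv⟩ :=
      abel_mooreOsgood K D (C / T ^ 2) (c / T ^ 2) (by positivity) hlip habel htl hfloor
    exact ⟨κT, hκT, D, fun N => (hD N).1, hconv⟩
  -- the conductivity and clause (ii) for every flip-steady family
  refine ⟨fun T => if hT : 0 < T then (hmain T hT).choose else 1, fun T hT => ?_, fun μ hμ T hT => ?_⟩
  · simp only [dif_pos hT]
    exact (hmain T hT).choose_spec.1
  · obtain ⟨D, hD, hconv⟩ := (hmain T hT).choose_spec.2
    refine ⟨D, fun N => ?_, ?_⟩
    · -- any flip-steady family has the reference family's response quotients near δ = 0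
      refine (hD N).congr' ?_
      have hball : Set.Ioo (-(2 * T)) (2 * T) ∈ 𝓝 (0 : ℝ) := Ioo_mem_nhds (by linarith) (by linarith)
      filter_upwards [mem_nhdsWithin_of_mem_nhds hball] with δ hδ
      have h1 : 0 < T + δ / 2 := by linarith [hδ.1]
      have h2 : 0 < T - δ / 2 := by linarith [hδ.2]
      rw [huniq N _ _ h1 h2 _ (hμ N _ _ h1 h2)]
    · simp only [dif_pos hT]
      exact hconv

/-- **The skeleton concludes the crux BY NAME**: `VanishingNoiseTransfer.NoisyFourier`
(stmt-AtomisticToContinuum-11977) from the seven registered stubs, through the sorry-free composition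
`flipFouriersLawFor_of_parts : NoisyNessExistsUnique → AbelCorrectorWellPosed → NoisyKuboAbel →
FixedAbelThermodynamicLimit → KapitzaBound → AbelTransfer → ThomsonFloor → (∀ params ε > 0, FlipFouriersLawFor …)`
(the crux's equivalent form, Disproof `noisyFourier_iff`); the route's bound predicate `S` is the inlined normal form
of `IsFlipSteadyState` (`isFlipSteadyState_fun_eq`, `rfl`), removed by `subst`. This theorem becomes the crux proof
when the last `stub_*` lands. -/
theorem NoisyFourier_of : NoisyFourier := by
  intro ω₂ lam β γ hω hl hβ hγ S hS ε hε
  subst hS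
  exact flipFouriersLawFor_of_parts stub_noisyNessExistsUnique stub_abelCorrectorWellPosed stub_noisyKuboAbel
    stub_fixedAbelThermodynamicLimit stub_kapitzaBound stub_abelTransfer stub_thomsonFloor hω hl hβ hγ hε

end Summit.AtomisticToContinuum.FouriersLaw.Cruxes.NoisyFourier.AbelKapitzaEvenCorrector
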